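import Mathlib.Analysis.SpecialFunctions.Complex.Log
import Mathlib.Analysis.SpecialFunctions.Complex.Arg
import Mathlib.Analysis.SpecialFunctions.Pow.Real
import HarnessLib

/-!
# Continuous one-parameter groups and automorphisms of the circle

Topic `Literature/Analysis/Complex`. Two classical rigidity statements about the unit circle
`S¹ = {‖z‖ = 1} ⊆ ℂ`, proved from scratch (Mathlib has the group `Circle` and `Circle.exp`
but, at the pinned version, no classification of the continuous homomorphisms `ℝ → S¹` or
`S¹ → S¹`):

* `Literature.Analysis.Complex.exists_eq_exp_of_continuous_unitary_hom`: a continuous `f : ℝ → ℂ` with `‖f t‖ = 1` and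
  `f (s + t) = f s * f t` is `t ↦ e^{ikt}` for a real `k` (dyadic-bisection proof: near `0` the
  values have positive real part, which pins down the square roots `f (δ/2ⁿ)`; then density of
  the dyadic multiples of `δ` and continuity).
* `Literature.Analysis.Complex.eq_exp_or_eq_exp_neg_of_injOn`: if moreover `f (2π) = 1` and `f` is injective on
  `[0, 2π)`, then `k = ±1`.
* `Literature.Analysis.Complex.circle_hom_eq_mul_or_mul_conj`: a continuous injective map `ψ : S¹ → S¹` with
  `ψ(ab) ψ(1) = ψ(a) ψ(b)` is `ζ ↦ ψ(1) ζ` or `ζ ↦ ψ(1) ζ̄` (the continuous automorphisms of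
  the circle group are `ζ ↦ ζ^{±1}`).

All statements are folklore (e.g. Hewitt–Ross, *Abstract Harmonic Analysis I*, (23.27), or any
text on topological groups); they serve the rigidity step of
`Literature/Barriers/CriticalPhenomena/EmbeddingModulusUniquenessProofs` (Beffara's "shears
distort the conformal modulus").

## Mathlib

USED: `Complex.exp_eq_one_iff`, `Complex.exp_eq_exp_iff_exists_int`,
`Complex.norm_mul_exp_arg_mul_I`, `Complex.abs_arg_lt_pi_div_two_iff`,
`Complex.exp_ofReal_mul_I_re`, `Real.cos_pos_of_mem_Ioo`, `sq_eq_sq_iff_eq_or_eq_neg`,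
`Int.floor_le`, `Int.lt_floor_add_one`, `tendsto_pow_atTop_nhds_zero_of_lt_one`,
`Int.abs_lt_one_iff`.
-/

noncomputable section

open Set Filter Topology Complex Metric
open scoped Real ComplexConjugate

namespace Literature.Analysis.Complex

/-! ### Continuous unitary one-parameter groups `ℝ → S¹` -/

section OneParameter

variable {f : ℝ → ℂ}

/-- A unitary one-parameter group has `f 0 = 1`. [folklore] -/
theorem unitaryHom_zero (h1 : ∀ t, ‖f t‖ = 1) (hmul : ∀ s t, f (s + t) = f s * f t) : f 0 = 1 := by
  have h := hmul 0 0
  rw [add_zero] at h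
  have h0 : f 0 ≠ 0 := norm_ne_zero_iff.1 (by rw [h1]; exact one_ne_zero)
  calc f 0 = f 0 * f 0 * (f 0)⁻¹ := by rw [mul_inv_cancel_right₀ h0]
    _ = f 0 * (f 0)⁻¹ := by rw [← h]
    _ = 1 := mul_inv_cancel₀ h0

/-- Natural multiples: `f (n t) = (f t) ^ n`. [folklore] -/
theorem unitaryHom_nat_mul (h1 : ∀ t, ‖f t‖ = 1) (hmul : ∀ s t, f (s + t) = f s * f t)
    (t : ℝ) (n : ℕ) : f (n * t) = f t ^ n := by
  induction n with
  | zero => simpa using unitaryHom_zero h1 hmul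
  | succ n ih => rw [Nat.cast_succ, add_mul, one_mul, hmul, ih, pow_succ]

/-- Negatives: `f (-t) = (f t)⁻¹`. [folklore] -/
theorem unitaryHom_neg (h1 : ∀ t, ‖f t‖ = 1) (hmul : ∀ s t, f (s + t) = f s * f t) (t : ℝ) :
    f (-t) = (f t)⁻¹ := by
  have h := hmul t (-t)
  rw [add_neg_cancel, unitaryHom_zero h1 hmul] at h
  have h0 : f t ≠ 0 := norm_ne_zero_iff.1 (by rw [h1]; exact one_ne_zero)
  exact (eq_inv_of_mul_eq_one_right h.symm)

/-- Integer multiples: `f (m t) = (f t) ^ m`. [folklore] -/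
theorem unitaryHom_int_mul (h1 : ∀ t, ‖f t‖ = 1) (hmul : ∀ s t, f (s + t) = f s * f t) (t : ℝ)
    (m : ℤ) : f (m * t) = f t ^ m := by
  obtain ⟨n, rfl | rfl⟩ := m.eq_nat_or_neg
  · simpa using unitaryHom_nat_mul h1 hmul t n
  · rw [Int.cast_neg, Int.cast_natCast, neg_mul, unitaryHom_neg h1 hmul, zpow_neg, zpow_natCast,
      unitaryHom_nat_mul h1 hmul]

/-- **Continuous unitary one-parameter groups are exponentials**: a continuous `f : ℝ → ℂ`
with `‖f t‖ = 1` and `f (s + t) = f s f t` is `f t = exp (i k t)` for some real `k`. Proof by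
dyadic bisection: on `[-δ, δ]` the values have positive real part; writing `f δ = e^{iθ}` with
`|θ| < π/2`, the unique square roots with positive real part give `f (δ/2ⁿ) = e^{iθ/2ⁿ}`, hence
`f = e^{ik·}` (`k = θ/δ`) on the dyadic multiples of `δ`, a dense set. [folklore] -/
theorem exists_eq_exp_of_continuous_unitary_hom (hf : Continuous f) (h1 : ∀ t, ‖f t‖ = 1)
    (hmul : ∀ s t, f (s + t) = f s * f t) : ∃ k : ℝ, ∀ t, f t = exp (k * t * I) := by
  have hf0 : f 0 = 1 := unitaryHom_zero h1 hmul
  -- Step 1: positive real part near `0`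
  obtain ⟨δ, hδ, hre⟩ : ∃ δ > 0, ∀ t, |t| ≤ δ → 0 < (f t).re := by
    have hpos0 : (0 : ℝ) < (f 0).re := by rw [hf0]; simp
    have hev : ∀ᶠ t in 𝓝 (0 : ℝ), 0 < (f t).re :=
      (continuous_re.comp hf).continuousAt.eventually (lt_mem_nhds hpos0)
    obtain ⟨ε, hε, hball⟩ := Metric.eventually_nhds_iff.1 hev
    refine ⟨ε / 2, half_pos hε, fun t ht ↦ hball ?_⟩
    rw [Real.dist_eq, sub_zero]
    exact lt_of_le_of_lt ht (half_lt_self hε)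
  -- Step 2: `f δ = exp (θ I)` with `|θ| < π/2`
  set θ : ℝ := arg (f δ) with hθ
  have hθlt : |θ| < π / 2 := by
    rw [hθ, abs_arg_lt_pi_div_two_iff]
    exact Or.inl (hre δ (by rw [abs_of_pos hδ]))
  have hfδ : f δ = exp (θ * I) := by
    have := norm_mul_exp_arg_mul_I (f δ)
    rw [h1, ofReal_one, one_mul] at this
    rw [hθ, this]
  -- Step 3: bisection, `f (δ / 2^n) = exp (θ / 2^n * I)`
  have hbis : ∀ n : ℕ, f (δ / 2 ^ n) = exp ((θ / 2 ^ n : ℝ) * I) := by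
    intro n
    induction n with
    | zero => simpa using hfδ
    | succ n ih =>
      set a := f (δ / 2 ^ (n + 1)) with ha
      set b := exp ((θ / 2 ^ (n + 1) : ℝ) * I) with hb
      have hsq : a ^ 2 = b ^ 2 := by
        have h2 : δ / 2 ^ n = δ / 2 ^ (n + 1) + δ / 2 ^ (n + 1) := by rw [pow_succ]; ring
        have hb2 : b ^ 2 = exp ((θ / 2 ^ n : ℝ) * I) := by
          rw [hb, sq, ← Complex.exp_add]
          congr 1
          push_cast
          rw [pow_succ]; ring
        rw [hb2, ← ih, h2, hmul, ha, sq]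
      rcases sq_eq_sq_iff_eq_or_eq_neg.1 hsq with h | h
      · exact h
      · exfalso
        have hcos : 0 < Real.cos (θ / 2 ^ (n + 1)) := by
          have hθn : |θ / 2 ^ (n + 1)| ≤ |θ| := by
            rw [abs_div, abs_of_pos (by positivity : (0 : ℝ) < 2 ^ (n + 1))]
            exact div_le_self (abs_nonneg θ) (one_le_pow₀ (by norm_num))
          have h3 := abs_lt.1 (hθn.trans_lt hθlt)
          exact Real.cos_pos_of_mem_Ioo ⟨by linarith [h3.1], by linarith [h3.2]⟩
        have hreb : b.re = Real.cos (θ / 2 ^ (n + 1)) := by rw [hb, exp_ofReal_mul_I_re]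
        have hrea : 0 < a.re := by
          rw [ha]
          refine hre _ ?_
          rw [abs_of_pos (by positivity)]
          exact div_le_self hδ.le (one_le_pow₀ (by norm_num))
        rw [h, neg_re, hreb] at hrea
        linarith
  -- Step 4: `f = exp (i k ·)` on dyadic multiples of `δ`
  set k : ℝ := θ / δ with hk
  have hdy : ∀ (n : ℕ) (m : ℤ), f (m * (δ / 2 ^ n)) = exp (k * (m * (δ / 2 ^ n) : ℝ) * I) := by
    intro n m
    rw [unitaryHom_int_mul h1 hmul, hbis n, ← Complex.exp_int_mul]
    congr 1
    have hδ0 : (δ : ℂ) ≠ 0 := by exact_mod_cast hδ.ne'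
    rw [hk]
    push_cast
    field_simp
  -- Step 5: density and continuity
  refine ⟨k, fun t ↦ ?_⟩
  set u : ℕ → ℝ := fun n ↦ (⌊t / (δ / 2 ^ n)⌋ : ℤ) * (δ / 2 ^ n) with hu
  have hut : Tendsto u atTop (𝓝 t) := by
    have hpos : ∀ n : ℕ, 0 < δ / 2 ^ n := fun n ↦ by positivity
    have hle : ∀ n, u n ≤ t := fun n ↦ by
      rw [hu]
      exact (le_div_iff₀ (hpos n)).1 (Int.floor_le _)
    have hge : ∀ n, t - δ / 2 ^ n ≤ u n := fun n ↦ by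
      rw [hu]
      have := (Int.lt_floor_add_one (t / (δ / 2 ^ n)))
      have h' : t < ((⌊t / (δ / 2 ^ n)⌋ : ℤ) + 1) * (δ / 2 ^ n) := (div_lt_iff₀ (hpos n)).1 this
      linarith
    have hlow : Tendsto (fun n : ℕ ↦ t - δ / 2 ^ n) atTop (𝓝 t) := by
      have : Tendsto (fun n : ℕ ↦ δ / 2 ^ n) atTop (𝓝 0) := by
        have h := (tendsto_pow_atTop_nhds_zero_of_lt_one (r := (1 / 2 : ℝ)) (by norm_num)
          (by norm_num)).const_mul δ
        rw [mul_zero] at h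
        refine h.congr fun n ↦ ?_
        rw [one_div, inv_pow, div_eq_mul_inv]
      simpa using (tendsto_const_nhds (x := t)).sub this
    exact tendsto_of_tendsto_of_tendsto_of_le_of_le hlow tendsto_const_nhds hge hle
  have hlim1 : Tendsto (fun n ↦ f (u n)) atTop (𝓝 (f t)) := (hf.tendsto t).comp hut
  have hlim2 : Tendsto (fun n ↦ f (u n)) atTop (𝓝 (exp (k * t * I))) := by
    have hc : Continuous fun s : ℝ ↦ exp (k * s * I) := by fun_prop
    refine ((hc.tendsto t).comp hut).congr fun n ↦ ?_
    simp only [Function.comp_apply]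
    rw [hu]
    exact (hdy n _).symm
  exact tendsto_nhds_unique hlim1 hlim2

end OneParameter

/-! ### Periodic and injective one-parameter groups -/

/-- If a continuous unitary one-parameter group is `2π`-periodic (`f (2π) = 1`) and injective on
`[0, 2π)`, then `f t = e^{it}` for all `t` or `f t = e^{-it}` for all `t`: the frequency `k` of
`exists_eq_exp_of_continuous_unitary_hom` is an integer by periodicity, non-zero and of absolute
value `< 2` by injectivity (`f (2π/|k|) = 1 = f 0`). [folklore] -/
theorem eq_exp_or_eq_exp_neg_of_injOn {f : ℝ → ℂ} (hf : Continuous f) (h1 : ∀ t, ‖f t‖ = 1)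
    (hmul : ∀ s t, f (s + t) = f s * f t) (h2π : f (2 * π) = 1) (hinj : InjOn f (Ico 0 (2 * π))) :
    (∀ t, f t = exp (t * I)) ∨ (∀ t, f t = exp (-(t * I))) := by
  obtain ⟨k, hk⟩ := exists_eq_exp_of_continuous_unitary_hom hf h1 hmul
  -- `k` is an integer
  obtain ⟨n, hn⟩ : ∃ n : ℤ, k = n := by
    have h := hk (2 * π)
    rw [h2π, eq_comm, exp_eq_one_iff] at h
    obtain ⟨n, hn⟩ := h
    refine ⟨n, ?_⟩
    have hI : (2 * π * I : ℂ) ≠ 0 := by simp [Real.pi_ne_zero, I_ne_zero]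
    have : (k : ℂ) * (2 * π * I) = n * (2 * π * I) := by
      rw [← hn]; push_cast; ring
    exact_mod_cast mul_right_cancel₀ hI this
  have hf0 : f 0 = 1 := unitaryHom_zero h1 hmul
  have h0mem : (0 : ℝ) ∈ Ico 0 (2 * π) := ⟨le_rfl, by positivity⟩
  -- `n ≠ 0`
  have hn0 : n ≠ 0 := by
    rintro rfl
    have h : f π = 1 := by rw [hk π, hn]; simp
    have hπmem : π ∈ Ico 0 (2 * π) := ⟨Real.pi_pos.le, by linarith [Real.pi_pos]⟩
    have := hinj hπmem h0mem (h.trans hf0.symm)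
    exact Real.pi_ne_zero this
  -- `|n| < 2`
  have habs : |n| < 2 := by
    by_contra hge
    have hge : 2 ≤ |n| := not_lt.1 hge
    have hpos : (0 : ℝ) < |(n : ℝ)| := by
      rw [← Int.cast_abs]; exact_mod_cast (abs_pos.2 hn0)
    set t₀ : ℝ := 2 * π / |(n : ℝ)| with ht₀
    have ht₀mem : t₀ ∈ Ico 0 (2 * π) := by
      refine ⟨by positivity, ?_⟩
      rw [ht₀, div_lt_iff₀ hpos]
      have : (2 : ℝ) ≤ |(n : ℝ)| := by rw [← Int.cast_abs]; exact_mod_cast hge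
      nlinarith [Real.pi_pos]
    have hft₀ : f t₀ = 1 := by
      rw [hk t₀, hn, exp_eq_one_iff]
      rcases le_or_gt 0 n with hnn | hnn
      · refine ⟨1, ?_⟩
        have : |(n : ℝ)| = n := by rw [← Int.cast_abs, abs_of_nonneg hnn]
        rw [ht₀, this]
        have hn' : (n : ℂ) ≠ 0 := by exact_mod_cast hn0
        field_simp
        push_cast
        field_simp
      · refine ⟨-1, ?_⟩
        have : |(n : ℝ)| = -n := by rw [← Int.cast_abs, abs_of_neg hnn]; push_cast; ring
        rw [ht₀, this]
        have hn' : (n : ℂ) ≠ 0 := by exact_mod_cast hn0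
        push_cast
        field_simp
    have := hinj ht₀mem h0mem (hft₀.trans hf0.symm)
    have : t₀ ≠ 0 := by positivity
    contradiction
  -- so `n = 1` or `n = -1`
  have hn1 : n = 1 ∨ n = -1 := by
    rcases abs_lt.1 habs with ⟨hl, hr⟩
    omega
  rcases hn1 with rfl | rfl
  · left; intro t; rw [hk t, hn]; simp
  · right; intro t; rw [hk t, hn]; simp

/-! ### Continuous injective automorphisms of the circle group -/

/-- **Rigidity of the circle group.** A map `ψ : ℂ → ℂ` that is continuous and injective on the
unit circle, maps it into itself, and is multiplicative up to the constant `ψ 1`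
(`ψ(ab) ψ(1) = ψ(a) ψ(b)`, i.e. `ψ/ψ(1)` is a group endomorphism of `S¹`), is the rotation
`ζ ↦ ψ(1) ζ` or the reflection `ζ ↦ ψ(1) ζ̄` on the circle. (Pull back along `t ↦ e^{it}` and
apply `eq_exp_or_eq_exp_neg_of_injOn`.) [folklore] -/
theorem circle_hom_eq_mul_or_mul_conj {ψ : ℂ → ℂ} (hc : ContinuousOn ψ (sphere 0 1))
    (hm : MapsTo ψ (sphere 0 1) (sphere 0 1)) (hi : InjOn ψ (sphere 0 1))
    (hhom : ∀ a ∈ sphere (0 : ℂ) 1, ∀ b ∈ sphere (0 : ℂ) 1, ψ (a * b) * ψ 1 = ψ a * ψ b) :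
    (∀ ζ ∈ sphere (0 : ℂ) 1, ψ ζ = ψ 1 * ζ) ∨ (∀ ζ ∈ sphere (0 : ℂ) 1, ψ ζ = ψ 1 * conj ζ) := by
  have hmem : ∀ t : ℝ, exp (t * I) ∈ sphere (0 : ℂ) 1 := fun t ↦ by
    simp [norm_exp_ofReal_mul_I]
  have h1mem : (1 : ℂ) ∈ sphere (0 : ℂ) 1 := by simp
  have hψ1 : ‖ψ 1‖ = 1 := mem_sphere_zero_iff_norm.1 (hm h1mem)
  have hψ10 : ψ 1 ≠ 0 := norm_ne_zero_iff.1 (by rw [hψ1]; exact one_ne_zero)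
  set f : ℝ → ℂ := fun t ↦ ψ (exp (t * I)) * (ψ 1)⁻¹ with hfdef
  have hf : Continuous f := by
    have he : Continuous fun t : ℝ ↦ exp (t * I) := by fun_prop
    have : Continuous fun t : ℝ ↦ ψ (exp (t * I)) :=
      hc.comp_continuous he fun t ↦ hmem t
    exact this.mul continuous_const
  have hn1 : ∀ t, ‖f t‖ = 1 := fun t ↦ by
    rw [hfdef]
    simp only [norm_mul, norm_inv, hψ1, mem_sphere_zero_iff_norm.1 (hm (hmem t))]
    norm_num
  have hmul : ∀ s t, f (s + t) = f s * f t := fun s t ↦ by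
    simp only [hfdef]
    have h := hhom _ (hmem s) _ (hmem t)
    have e : exp (((s + t : ℝ) : ℂ) * I) = exp (s * I) * exp (t * I) := by
      rw [← Complex.exp_add]; congr 1; push_cast; ring
    have h' : ψ (exp (s * I) * exp (t * I)) = ψ (exp (s * I)) * ψ (exp (t * I)) * (ψ 1)⁻¹ := by
      rw [eq_mul_inv_iff_mul_eq₀ hψ10]; exact h
    rw [e, h']
    ring
  have h2π : f (2 * π) = 1 := by
    simp only [hfdef]
    have : exp ((2 * π : ℝ) * I) = 1 := by
      rw [exp_eq_one_iff]; exact ⟨1, by push_cast; ring⟩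
    rw [this, mul_inv_cancel₀ hψ10]
  have hinj : InjOn f (Ico 0 (2 * π)) := by
    intro s hs t ht hst
    simp only [hfdef] at hst
    have h' : ψ (exp (s * I)) = ψ (exp (t * I)) := mul_right_cancel₀ (inv_ne_zero hψ10) hst
    have h'' : exp (s * I) = exp (t * I) := hi (hmem s) (hmem t) h'
    -- injectivity of `t ↦ e^{it}` on `[0, 2π)`
    rw [exp_eq_exp_iff_exists_int] at h''
    obtain ⟨n, hn⟩ := h''
    have hI : (I : ℂ) ≠ 0 := I_ne_zero
    have hst' : (s : ℂ) = t + n * (2 * π) := by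
      have := hn
      have h3 : (s : ℂ) * I = (t + n * (2 * π)) * I := by rw [this]; ring
      exact mul_right_cancel₀ hI h3
    have hst'' : s = t + n * (2 * π) := by exact_mod_cast hst'
    have hn0 : n = 0 := by
      have h3 : |(n : ℝ)| < 1 := by
        have : |s - t| < 2 * π := by
          rw [abs_lt]; constructor <;> linarith [hs.1, hs.2, ht.1, ht.2]
        rw [hst'', show t + (n : ℝ) * (2 * π) - t = n * (2 * π) by ring, abs_mul,
          abs_of_pos Real.two_pi_pos] at this
        nlinarith [Real.pi_pos, abs_nonneg (n : ℝ)]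
      have h4 : |n| < 1 := by exact_mod_cast h3
      exact Int.abs_lt_one_iff.1 h4
    rw [hst'', hn0]; simp
  -- every point of the circle is `e^{it}`
  have hsurj : ∀ ζ ∈ sphere (0 : ℂ) 1, ∃ t : ℝ, exp (t * I) = ζ := fun ζ hζ ↦ by
    refine ⟨arg ζ, ?_⟩
    have := norm_mul_exp_arg_mul_I ζ
    rwa [mem_sphere_zero_iff_norm.1 hζ, ofReal_one, one_mul] at this
  rcases eq_exp_or_eq_exp_neg_of_injOn hf hn1 hmul h2π hinj with h | h
  · left
    intro ζ hζ
    obtain ⟨t, rfl⟩ := hsurj ζ hζ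
    have := h t
    simp only [hfdef] at this
    calc ψ (exp (t * I)) = ψ (exp (t * I)) * (ψ 1)⁻¹ * ψ 1 := by
          rw [inv_mul_cancel_right₀ hψ10]
      _ = ψ 1 * exp (t * I) := by rw [this, mul_comm]
  · right
    intro ζ hζ
    obtain ⟨t, rfl⟩ := hsurj ζ hζ
    have := h t
    simp only [hfdef] at this
    have hconj : conj (exp (t * I)) = exp (-(t * I)) := by
      rw [← Complex.exp_conj]; congr 1; simp [conj_ofReal]
    calc ψ (exp (t * I)) = ψ (exp (t * I)) * (ψ 1)⁻¹ * ψ 1 := by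
          rw [inv_mul_cancel_right₀ hψ10]
      _ = ψ 1 * conj (exp (t * I)) := by rw [this, hconj, mul_comm]

end Literature.Analysis.Complex
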